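import Summits.KontsevichZagierPeriods.KontsevichZagierPeriods.Theorems.RootDecompRelativeModAbsoluteCylLogSplitP45

/-! # `RootDecompRelativeModAbsoluteCylLogSplitP46` — part 21/27 of the mechanical ≤400-line split of `RungClosure.lean` (sha256 f909f334226f0fb5…)
Source: decomp-kz lens-3 g12 `RungClosure.lean` v9 (HOME/decomp-kz-lens-3/g12/, sha256 f909f334…; critic g4-52/g4-57/g5 CLEARED, «lander: split v9 --supports 30572»): BLOCK I (57 g11 monolith decls missing from P01–P25), BLOCK II/III (WildCertAssembly parts 1–6, 8–10: `Leaf.cellLocalWildCert`, `Leaf.cylKernelZeroLog_of_trees`), Parts 12–13 (`Leaf.regKernelPairDegOne_iff_circlePos_of_trees`), BLOCK G13 (Möbius engine, test §C decided).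
Split by census-1 g9 `gen/splitlean.py`: scopes re-opened with their `open`/`variable`/`set_option` context; mathematics and declaration order unchanged. -/

noncomputable section
open Set MeasureTheory Filter Topology
open scoped BigOperators
open Literature.NumberTheory.Transcendental Literature.ModelTheory.ExponentialFields
namespace Summit.KontsevichZagierPeriods.RootDecompRelativeModAbsolute.Rung30571.RegularisedLogLayer.CylLog.Leaf

/-- Pointwise kernel bounds on `(0,1)` for `0 ≤ λ < 1`:
`½·θ^M/(1−θλ) ≤ θ^M/(1−θ²λ²)` and `½·θ^M/(1+θλ) ≤ θ^M/(1−θ²λ²)` (and all three are `≥ 0`). -/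
theorem kernel_bounds (M : ℕ) {θ l : ℝ} (hθ0 : 0 < θ) (hθ1 : θ < 1) (hl0 : 0 ≤ l) (hl1 : l < 1) :
    0 ≤ θ ^ M / (1 + θ * -l) ∧ 0 ≤ θ ^ M / (1 + θ * l) ∧ 0 ≤ θ ^ M / (1 - θ ^ 2 * l ^ 2) ∧
    (1/2 : ℝ) * (θ ^ M / (1 + θ * -l)) ≤ θ ^ M / (1 - θ ^ 2 * l ^ 2) ∧
    (1/2 : ℝ) * (θ ^ M / (1 + θ * l)) ≤ θ ^ M / (1 - θ ^ 2 * l ^ 2) := by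
  have hθl : θ * l < 1 := by nlinarith
  have hθl0 : 0 ≤ θ * l := mul_nonneg hθ0.le hl0
  have hA : 0 < 1 + θ * -l := by nlinarith
  have hB : 0 < 1 + θ * l := by nlinarith
  have hC : 0 < 1 - θ ^ 2 * l ^ 2 := by
    have : 1 - θ ^ 2 * l ^ 2 = (1 - θ * l) * (1 + θ * l) := by ring
    rw [this]; exact mul_pos (by linarith) hB
  have hM : 0 ≤ θ ^ M := pow_nonneg hθ0.le M
  refine ⟨div_nonneg hM hA.le, div_nonneg hM hB.le, div_nonneg hM hC.le, ?_, ?_⟩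
  · -- ½/(1−θl) ≤ 1/(1−θ²l²)  ⟸  (1−θ²l²) ≤ 2(1−θl) ⟸ (1+θl)(1-θl) ≤ 2(1-θl)
    rw [← mul_div_assoc, div_le_div_iff₀ hA hC]
    have : (1 - θ ^ 2 * l ^ 2) ≤ 2 * (1 + θ * -l) := by nlinarith
    nlinarith
  · rw [← mul_div_assoc, div_le_div_iff₀ hB hC]
    have h' : 1 - θ ^ 2 * l ^ 2 ≤ 1 + θ * l := by nlinarith
    nlinarith

/-- **The non-positive arctangent kind is LOG KIND (PROVED):** `CylKernelZeroLog ⟹ CylKernelZeroMixedNonpos`, by the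
partial fractions `θ^M/(1+θ²κ) = ½θ^M/(1−θλ) + ½θ^M/(1+θλ)`, `λ = √(−κ)`, reindexing the family over `Fin (q + q)`. -/
theorem cylKernelZeroMixedNonpos_of_log (hL : CylKernelZeroLog) : CylKernelZeroMixedNonpos := by
  intro P V a₀ q c κ M e hP ha₀ ha₀i hc hκ he _h2 hκ1 hκ0 hint hL1 hdom hV hae
  have hPm : MeasurableSet P := hP.measurableSet_holds
  have he1 : ∀ i, ¬ e i = 2 → e i = 1 := fun i h => (he i).resolve_right h
  -- `λᵢ = √(−κᵢ)`
  set lam : Fin q → (Fin 1 → ℝ) → ℝ := fun i x => Real.sqrt (-κ i x) with hlamdef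
  have hlam0 : ∀ i x, 0 ≤ lam i x := fun i x => Real.sqrt_nonneg _
  have hlam1 : ∀ i, ∀ x ∈ P, lam i x < 1 := by
    intro i x hx
    show Real.sqrt (-κ i x) < 1
    rw [Real.sqrt_lt' one_pos]
    linarith [hκ1 i x hx]
  have hlamsq : ∀ i, e i = 2 → ∀ x ∈ P, lam i x ^ 2 = -κ i x := fun i hi x hx =>
    Real.sq_sqrt (by linarith [hκ0 i hi x hx])
  have hκeq : ∀ i, e i = 2 → ∀ x ∈ P, κ i x = -(lam i x) ^ 2 := fun i hi x hx => by
    have := hlamsq i hi x hx; linarith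
  have hlam_sa : ∀ i, IsSemialgebraicFunOn ℚ P (lam i) := by
    intro i
    have hneg : IsSemialgebraicFunOn ℚ P (fun x => -κ i x) :=
      (IsSemialgebraicFunOn.sub_holds (isSemialgebraicFunOn_ratCast hP 0) (hκ i)).congr fun _ _ => by simp
    exact IsSemialgebraicFunOn.sqrt_holds hneg
  have hnlam_sa : ∀ i, IsSemialgebraicFunOn ℚ P (fun x => -lam i x) := fun i =>
    (IsSemialgebraicFunOn.sub_holds (isSemialgebraicFunOn_ratCast hP 0) (hlam_sa i)).congr fun _ _ => by simp
  have hhalf_sa : ∀ i, IsSemialgebraicFunOn ℚ P (fun x => (1/2 : ℝ) * c i x) := fun i =>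
    (IsSemialgebraicFunOn.mul_holds (isSemialgebraicFunOn_ratCast hP (1/2 : ℚ)) (hc i)).congr
      fun _ _ => by simp only [Pi.mul_apply]; push_cast; ring
  have hzero_sa : IsSemialgebraicFunOn ℚ P (fun _ : Fin 1 → ℝ => (0:ℝ)) :=
    (isSemialgebraicFunOn_ratCast hP 0).congr fun _ _ => by simp
  -- the box
  set B : Set (Fin (1 + 1) → ℝ) := {z : Fin (1 + 1) → ℝ | (Fin.init z : Fin 1 → ℝ) ∈ P ∧ z (Fin.last 1) ∈ Set.Ioo 0 1}
    with hBdef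
  have hBsa : IsSemialgebraic ℚ B := RTerm.isSemialgebraic_cyl hP
  have hBm : MeasurableSet B := hBsa.measurableSet_holds
  have hBP : B ⊆ {z | (Fin.init z : Fin 1 → ℝ) ∈ P} := fun z hz => hz.1
  -- elementary facts at a point of the box / of `(0,1)`
  have hden : ∀ i, ∀ x ∈ P, ∀ θ ∈ Ioo (0:ℝ) 1, 1 - θ * lam i x ≠ 0 ∧ 1 + θ * lam i x ≠ 0 := by
    intro i x hx θ hθ
    have h0 := hlam0 i x; have h1 := hlam1 i x hx
    have : θ * lam i x < 1 := by nlinarith [hθ.1, hθ.2]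
    constructor <;> [exact (show (0:ℝ) < 1 - θ * lam i x by linarith).ne';
      exact (show (0:ℝ) < 1 + θ * lam i x by nlinarith [hθ.1]).ne']
  -- the new data over `Fin (q + q)`
  let c' : Fin (q + q) → (Fin 1 → ℝ) → ℝ :=
    Fin.append (fun i => if e i = 2 then (fun x => (1/2 : ℝ) * c i x) else c i)
      (fun i => if e i = 2 then (fun x => (1/2 : ℝ) * c i x) else fun _ => 0)
  let κ' : Fin (q + q) → (Fin 1 → ℝ) → ℝ :=
    Fin.append (fun i => if e i = 2 then (fun x => -lam i x) else κ i)
      (fun i => if e i = 2 then lam i else fun _ => 0)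
  let M' : Fin (q + q) → ℕ := Fin.append M M
  refine hL P V a₀ (q + q) c' κ' M' hP ha₀ ha₀i ?_ ?_ ?_ ?_ ?_ hdom ?_ ?_
  · -- `c'` semialgebraic
    intro j
    refine Fin.addCases (fun i => ?_) (fun i => ?_) j
    · simp only [c', Fin.append_left]
      by_cases h : e i = 2
      · simp only [h, ↓reduceIte]; exact hhalf_sa i
      · simp only [h, ↓reduceIte]; exact hc i
    · simp only [c', Fin.append_right]
      by_cases h : e i = 2
      · simp only [h, ↓reduceIte]; exact hhalf_sa i
      · simp only [h, ↓reduceIte]; exact hzero_sa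
  · -- `κ'` semialgebraic
    intro j
    refine Fin.addCases (fun i => ?_) (fun i => ?_) j
    · simp only [κ', Fin.append_left]
      by_cases h : e i = 2
      · simp only [h, ↓reduceIte]; exact hnlam_sa i
      · simp only [h, ↓reduceIte]; exact hκ i
    · simp only [κ', Fin.append_right]
      by_cases h : e i = 2
      · simp only [h, ↓reduceIte]; exact hlam_sa i
      · simp only [h, ↓reduceIte]; exact hzero_sa
  · -- `κ' > -1`
    intro j
    refine Fin.addCases (fun i => ?_) (fun i => ?_) j
    · simp only [κ', Fin.append_left]
      by_cases h : e i = 2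
      · simp only [h, ↓reduceIte]; intro x hx; linarith [hlam1 i x hx]
      · simp only [h, ↓reduceIte]; exact hκ1 i
    · simp only [κ', Fin.append_right]
      by_cases h : e i = 2
      · simp only [h, ↓reduceIte]; intro x hx; linarith [hlam0 i x]
      · simp only [h, ↓reduceIte]; intro x _; norm_num
  · -- termwise integrability on the box
    intro j
    refine Fin.addCases (fun i => ?_) (fun i => ?_) j
    · simp only [c', κ', M', Fin.append_left]
      by_cases h : e i = 2
      · simp only [h, ↓reduceIte]
        have hsa := sa_cylTerm (M i) hBsa hBP (hhalf_sa i) (hnlam_sa i) (fun z hz => by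
          have := (hden i _ hz.1 _ hz.2).1
          intro h0; apply this; linarith)
        refine Integrable.mono' (hint i).norm (KZ.aestronglyMeasurable_of_isSemialgebraicFunOn hsa hBm) ?_
        filter_upwards [ae_restrict_mem hBm] with z hz
        obtain ⟨k1n, -, k3n, hk1, -⟩ := kernel_bounds (M i) hz.2.1 hz.2.2 (hlam0 i _) (hlam1 i _ hz.1)
        have e3 : (1:ℝ) + z (Fin.last 1) ^ 2 * -(lam i (Fin.init z)) ^ 2 =
            1 - z (Fin.last 1) ^ 2 * lam i (Fin.init z) ^ 2 := by ring
        rw [h, hκeq i h _ hz.1, e3, Real.norm_eq_abs, Real.norm_eq_abs, abs_mul, abs_mul, abs_mul,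
          abs_of_nonneg k1n, abs_of_nonneg k3n, abs_of_nonneg (by norm_num : (0:ℝ) ≤ 1/2)]
        nlinarith [mul_le_mul_of_nonneg_left hk1 (abs_nonneg (c i (Fin.init z)))]
      · simp only [h, ↓reduceIte]
        have := hint i
        rw [he1 i h] at this
        simpa only [pow_one] using this
    · simp only [c', κ', M', Fin.append_right]
      by_cases h : e i = 2
      · simp only [h, ↓reduceIte]
        have hsa := sa_cylTerm (M i) hBsa hBP (hhalf_sa i) (hlam_sa i) (fun z hz => (hden i _ hz.1 _ hz.2).2)
        refine Integrable.mono' (hint i).norm (KZ.aestronglyMeasurable_of_isSemialgebraicFunOn hsa hBm) ?_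
        filter_upwards [ae_restrict_mem hBm] with z hz
        obtain ⟨-, k2n, k3n, -, hk2⟩ := kernel_bounds (M i) hz.2.1 hz.2.2 (hlam0 i _) (hlam1 i _ hz.1)
        have e3 : (1:ℝ) + z (Fin.last 1) ^ 2 * -(lam i (Fin.init z)) ^ 2 =
            1 - z (Fin.last 1) ^ 2 * lam i (Fin.init z) ^ 2 := by ring
        rw [h, hκeq i h _ hz.1, e3, Real.norm_eq_abs, Real.norm_eq_abs, abs_mul, abs_mul, abs_mul,
          abs_of_nonneg k2n, abs_of_nonneg k3n, abs_of_nonneg (by norm_num : (0:ℝ) ≤ 1/2)]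
        nlinarith [mul_le_mul_of_nonneg_left hk2 (abs_nonneg (c i (Fin.init z)))]
      · simp only [h, ↓reduceIte, zero_mul]
        exact integrableOn_zero
  · -- integrability of the fibre functions on the base
    intro j
    refine Fin.addCases (fun i => ?_) (fun i => ?_) j
    · simp only [c', κ', M', Fin.append_left]
      by_cases h : e i = 2
      · simp only [h, ↓reduceIte]
        have hmeas : AEStronglyMeasurable
            (fun x => (1/2 : ℝ) * c i x * ∫ θ in Ioo (0:ℝ) 1, θ ^ M i / (1 + θ * -lam i x)) (volume.restrict P) :=
          (KZ.aestronglyMeasurable_of_isSemialgebraicFunOn (hhalf_sa i) hPm).mul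
            (aestronglyMeasurable_fibreLog
              (KZ.aestronglyMeasurable_of_isSemialgebraicFunOn (hnlam_sa i) hPm).aemeasurable (M i))
        refine Integrable.mono' (hL1 i).norm hmeas ?_
        filter_upwards [ae_restrict_mem hPm] with x hx
        have hl0 := hlam0 i x; have hl1 := hlam1 i x hx
        have hI1 : IntegrableOn (fun θ : ℝ => θ ^ M i / (1 + θ * -lam i x)) (Ioo (0:ℝ) 1) :=
          integrableOn_kernel_lin (M i) (by linarith)
        have hI3 : IntegrableOn (fun θ : ℝ => θ ^ M i / (1 - θ ^ 2 * lam i x ^ 2)) (Ioo (0:ℝ) 1) :=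
          integrableOn_kernel_sq (M i) hl0 hl1
        have hJ1n : 0 ≤ ∫ θ in Ioo (0:ℝ) 1, θ ^ M i / (1 + θ * -lam i x) :=
          setIntegral_nonneg measurableSet_Ioo fun θ hθ => (kernel_bounds (M i) hθ.1 hθ.2 hl0 hl1).1
        have hJ3n : 0 ≤ ∫ θ in Ioo (0:ℝ) 1, θ ^ M i / (1 - θ ^ 2 * lam i x ^ 2) :=
          setIntegral_nonneg measurableSet_Ioo fun θ hθ => (kernel_bounds (M i) hθ.1 hθ.2 hl0 hl1).2.2.1
        have hle : (1/2 : ℝ) * (∫ θ in Ioo (0:ℝ) 1, θ ^ M i / (1 + θ * -lam i x)) ≤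
            ∫ θ in Ioo (0:ℝ) 1, θ ^ M i / (1 - θ ^ 2 * lam i x ^ 2) := by
          rw [← integral_const_mul]
          exact setIntegral_mono_on (hI1.const_mul _) hI3 measurableSet_Ioo
            fun θ hθ => (kernel_bounds (M i) hθ.1 hθ.2 hl0 hl1).2.2.2.1
        have e4 : (fun θ : ℝ => θ ^ M i / (1 + θ ^ 2 * -(lam i x) ^ 2)) =
            fun θ => θ ^ M i / (1 - θ ^ 2 * lam i x ^ 2) := by
          funext θ; ring
        rw [h, hκeq i h x hx, e4, Real.norm_eq_abs, Real.norm_eq_abs, abs_mul, abs_mul, abs_mul,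
          abs_of_nonneg hJ1n, abs_of_nonneg hJ3n, abs_of_nonneg (by norm_num : (0:ℝ) ≤ 1/2)]
        nlinarith [mul_le_mul_of_nonneg_left hle (abs_nonneg (c i x))]
      · simp only [h, ↓reduceIte]
        have := hL1 i
        rw [he1 i h] at this
        simpa only [pow_one] using this
    · simp only [c', κ', M', Fin.append_right]
      by_cases h : e i = 2
      · simp only [h, ↓reduceIte]
        have hmeas : AEStronglyMeasurable
            (fun x => (1/2 : ℝ) * c i x * ∫ θ in Ioo (0:ℝ) 1, θ ^ M i / (1 + θ * lam i x)) (volume.restrict P) :=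
          (KZ.aestronglyMeasurable_of_isSemialgebraicFunOn (hhalf_sa i) hPm).mul
            (aestronglyMeasurable_fibreLog
              (KZ.aestronglyMeasurable_of_isSemialgebraicFunOn (hlam_sa i) hPm).aemeasurable (M i))
        refine Integrable.mono' (hL1 i).norm hmeas ?_
        filter_upwards [ae_restrict_mem hPm] with x hx
        have hl0 := hlam0 i x; have hl1 := hlam1 i x hx
        have hI2 : IntegrableOn (fun θ : ℝ => θ ^ M i / (1 + θ * lam i x)) (Ioo (0:ℝ) 1) :=
          integrableOn_kernel_lin (M i) (by linarith)
        have hI3 : IntegrableOn (fun θ : ℝ => θ ^ M i / (1 - θ ^ 2 * lam i x ^ 2)) (Ioo (0:ℝ) 1) :=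
          integrableOn_kernel_sq (M i) hl0 hl1
        have hJ2n : 0 ≤ ∫ θ in Ioo (0:ℝ) 1, θ ^ M i / (1 + θ * lam i x) :=
          setIntegral_nonneg measurableSet_Ioo fun θ hθ => (kernel_bounds (M i) hθ.1 hθ.2 hl0 hl1).2.1
        have hJ3n : 0 ≤ ∫ θ in Ioo (0:ℝ) 1, θ ^ M i / (1 - θ ^ 2 * lam i x ^ 2) :=
          setIntegral_nonneg measurableSet_Ioo fun θ hθ => (kernel_bounds (M i) hθ.1 hθ.2 hl0 hl1).2.2.1
        have hle : (1/2 : ℝ) * (∫ θ in Ioo (0:ℝ) 1, θ ^ M i / (1 + θ * lam i x)) ≤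
            ∫ θ in Ioo (0:ℝ) 1, θ ^ M i / (1 - θ ^ 2 * lam i x ^ 2) := by
          rw [← integral_const_mul]
          exact setIntegral_mono_on (hI2.const_mul _) hI3 measurableSet_Ioo
            fun θ hθ => (kernel_bounds (M i) hθ.1 hθ.2 hl0 hl1).2.2.2.2
        have e4 : (fun θ : ℝ => θ ^ M i / (1 + θ ^ 2 * -(lam i x) ^ 2)) =
            fun θ => θ ^ M i / (1 - θ ^ 2 * lam i x ^ 2) := by
          funext θ; ring
        rw [h, hκeq i h x hx, e4, Real.norm_eq_abs, Real.norm_eq_abs, abs_mul, abs_mul, abs_mul,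
          abs_of_nonneg hJ2n, abs_of_nonneg hJ3n, abs_of_nonneg (by norm_num : (0:ℝ) ≤ 1/2)]
        nlinarith [mul_le_mul_of_nonneg_left hle (abs_nonneg (c i x))]
      · simp only [h, ↓reduceIte, zero_mul]
        exact integrableOn_zero
  · -- the integrand of `V`
    intro z hz
    have hzB : (Fin.init z : Fin 1 → ℝ) ∈ P ∧ z (Fin.last 1) ∈ Ioo (0:ℝ) 1 := by rw [hdom] at hz; exact hz
    have key : (∑ j : Fin (q + q), c' j (Fin.init z) *
          (z (Fin.last 1) ^ M' j / (1 + z (Fin.last 1) * κ' j (Fin.init z)))) =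
        ∑ i, c i (Fin.init z) * (z (Fin.last 1) ^ M i / (1 + z (Fin.last 1) ^ e i * κ i (Fin.init z))) := by
      rw [Fin.sum_univ_add]
      simp only [c', κ', M', Fin.append_left, Fin.append_right]
      rw [← Finset.sum_add_distrib]
      refine Finset.sum_congr rfl fun i _ => ?_
      by_cases h : e i = 2
      · simp only [h, ↓reduceIte]
        obtain ⟨h1ne, h2ne⟩ := hden i _ hzB.1 _ hzB.2
        have hk := half_kernel_add (M i) (θ := z (Fin.last 1)) (l := lam i (Fin.init z)) h1ne h2ne
        have e3 : (1:ℝ) + z (Fin.last 1) ^ 2 * -(lam i (Fin.init z)) ^ 2 =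
            1 - z (Fin.last 1) ^ 2 * lam i (Fin.init z) ^ 2 := by ring
        rw [hκeq i h _ hzB.1, e3, ← hk]
        ring
      · simp only [h, ↓reduceIte]
        simp only [he1 i h, pow_one, zero_mul, add_zero]
    show V.integrand z = a₀ (Fin.init z) + ∑ j : Fin (q + q), c' j (Fin.init z) *
      (z (Fin.last 1) ^ M' j / (1 + z (Fin.last 1) * κ' j (Fin.init z)))
    rw [key]
    exact hV hz
  · -- the a.e. vanishing of the fibre integrals
    filter_upwards [hae] with x hx hxP
    have key : (∑ j : Fin (q + q), c' j x * ∫ θ in Ioo (0:ℝ) 1, θ ^ M' j / (1 + θ * κ' j x)) =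
        ∑ i, c i x * ∫ θ in Ioo (0:ℝ) 1, θ ^ M i / (1 + θ ^ e i * κ i x) := by
      rw [Fin.sum_univ_add]
      simp only [c', κ', M', Fin.append_left, Fin.append_right]
      rw [← Finset.sum_add_distrib]
      refine Finset.sum_congr rfl fun i _ => ?_
      by_cases h : e i = 2
      · simp only [h, ↓reduceIte]
        have hl0 := hlam0 i x; have hl1 := hlam1 i x hxP
        have hI1 : IntegrableOn (fun θ : ℝ => θ ^ M i / (1 + θ * -lam i x)) (Ioo (0:ℝ) 1) :=
          integrableOn_kernel_lin (M i) (by linarith)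
        have hI2 : IntegrableOn (fun θ : ℝ => θ ^ M i / (1 + θ * lam i x)) (Ioo (0:ℝ) 1) :=
          integrableOn_kernel_lin (M i) (by linarith)
        have e4 : (fun θ : ℝ => θ ^ M i / (1 + θ ^ 2 * -(lam i x) ^ 2)) =
            fun θ => θ ^ M i / (1 - θ ^ 2 * lam i x ^ 2) := by
          funext θ; ring
        rw [hκeq i h x hxP, e4]
        have hsum : (∫ θ in Ioo (0:ℝ) 1, θ ^ M i / (1 - θ ^ 2 * lam i x ^ 2)) =
            ∫ θ in Ioo (0:ℝ) 1, ((1/2 : ℝ) * (θ ^ M i / (1 + θ * -lam i x)) +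
              (1/2 : ℝ) * (θ ^ M i / (1 + θ * lam i x))) := by
          refine setIntegral_congr_fun measurableSet_Ioo fun θ hθ => ?_
          obtain ⟨h1ne, h2ne⟩ := hden i x hxP θ hθ
          exact (half_kernel_add (M i) h1ne h2ne).symm
        rw [hsum, integral_add (hI1.const_mul _) (hI2.const_mul _), integral_const_mul, integral_const_mul]
        ring
      · simp only [h, ↓reduceIte]
        simp only [he1 i h, pow_one, zero_mul, add_zero]
    rw [key]
    exact hx hxP

/-! ### Part 13 (g12): THE RESIDUAL IS THE PURE POSITIVE CIRCLE KIND ON OPEN CELLS —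
`CylKernelZeroMixed ⟺ CylKernelZeroCirclePos` given `CylKernelZeroLog` (PROVED)

Sign cells (landed §3x `exists_sign_cells` on an open full-measure sub-base where the `κᵢ` are smooth, landed §3v
`exists_restrict_parts_ae`): on each open cell every arctangent-kind term has `κᵢ > 0`, `κᵢ < 0` or `κᵢ ≡ 0`.  On a cell,
the NON-POSITIVE arctangent terms are converted to log kind by the partial fractions of Part 12 (`λ = √(−κ)`,
reindexing over `Fin (q + q)`), so either a positive arctangent term survives — and the cell is an instance of the pure
positive circle kind `CylKernelZeroCirclePos` — or none does and the cell is `CylKernelZeroMixedNonpos ⟸ CylKernelZeroLog`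
(Part 12).  Consequently the residual of item 30572 after g12 is EXACTLY `CylKernelZeroCirclePos`. -/

/-- **`CylKernelZeroCirclePos`** — THE RESIDUAL of item 30572 after g12 (Parts 12–13): `CylKernelZeroMixed` on an OPEN
`ℚ`-sa base `P ⊆ ℝ`, for families in which EVERY arctangent-kind term (`eᵢ = 2`) has `κᵢ > 0` on all of `P` (pure positive
circle kind: the fibre integrals are `ℚ`-sa combinations of `arctan √κᵢ`, `log (1+κᵢ)` and the log-kind `log (1+κⱼ)`).
[tag: WEAKER than `CylKernelZeroMixed` (a specialisation, `cylKernelZeroCirclePos_of_mixed`), hence than `CylKernelZero`,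
the item and the summit; EQUIVALENT to `CylKernelZeroMixed` GIVEN the rung `CylKernelZeroLog`
(`cylKernelZeroMixed_iff_circlePos_of_log`); UNDECIDED · IDEA-NEEDED (joint log/circle Ax–Schanuel structure theorem —
multiplicative relations among positive units `1+κⱼ`, `1+κᵢ` and circle units `(1+i√κᵢ θ)/(1−i√κᵢ θ)` DECOUPLE by taking
absolute values — plus a circle boundary rigidity via the Möbius rotation `t ↦ (t+b)/(1−tb)`, KZ rule 2)] -/
def CylKernelZeroCirclePos : Prop :=
  ∀ (P : Set (Fin 1 → ℝ)) (V : KZ.IntegralRep (1 + 1)) (a₀ : (Fin 1 → ℝ) → ℝ) (q : ℕ)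
    (c κ : Fin q → (Fin 1 → ℝ) → ℝ) (M e : Fin q → ℕ),
    IsOpen P → IsSemialgebraic ℚ P → IsSemialgebraicFunOn ℚ P a₀ → IntegrableOn a₀ P →
    (∀ i, IsSemialgebraicFunOn ℚ P (c i)) → (∀ i, IsSemialgebraicFunOn ℚ P (κ i)) →
    (∀ i, e i = 1 ∨ e i = 2) → (∃ i, e i = 2) → (∀ i, ∀ x ∈ P, -1 < κ i x) →
    (∀ i, e i = 2 → ∀ x ∈ P, 0 < κ i x) →
    (∀ i, IntegrableOn (fun z : Fin (1 + 1) → ℝ =>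
      c i (Fin.init z) * (z (Fin.last 1) ^ M i / (1 + z (Fin.last 1) ^ e i * κ i (Fin.init z))))
      {z : Fin (1 + 1) → ℝ | (Fin.init z : Fin 1 → ℝ) ∈ P ∧ z (Fin.last 1) ∈ Set.Ioo 0 1}) →
    (∀ i, IntegrableOn (fun x => c i x * ∫ θ in Set.Ioo (0 : ℝ) 1, θ ^ M i / (1 + θ ^ e i * κ i x)) P) →
    V.domain = {z : Fin (1 + 1) → ℝ | (Fin.init z : Fin 1 → ℝ) ∈ P ∧ z (Fin.last 1) ∈ Set.Ioo 0 1} →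
    Set.EqOn V.integrand (fun z => a₀ (Fin.init z) +
      ∑ i, c i (Fin.init z) * (z (Fin.last 1) ^ M i / (1 + z (Fin.last 1) ^ e i * κ i (Fin.init z))))
      V.domain →
    (∀ᵐ x : (Fin 1 → ℝ), x ∈ P →
      a₀ x + ∑ i, c i x * ∫ θ in Set.Ioo (0 : ℝ) 1, θ ^ M i / (1 + θ ^ e i * κ i x) = 0) →
    KZ.of V ∈ KZ.relations

/-- **`CylKernelZeroMixedSigned`** — `CylKernelZeroMixed` on an open base on which every arctangent-kind term is either
positive everywhere or non-positive everywhere (the shape delivered by the sign cells). [bookkeeping intermediate] -/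
def CylKernelZeroMixedSigned : Prop :=
  ∀ (P : Set (Fin 1 → ℝ)) (V : KZ.IntegralRep (1 + 1)) (a₀ : (Fin 1 → ℝ) → ℝ) (q : ℕ)
    (c κ : Fin q → (Fin 1 → ℝ) → ℝ) (M e : Fin q → ℕ),
    IsOpen P → IsSemialgebraic ℚ P → IsSemialgebraicFunOn ℚ P a₀ → IntegrableOn a₀ P →
    (∀ i, IsSemialgebraicFunOn ℚ P (c i)) → (∀ i, IsSemialgebraicFunOn ℚ P (κ i)) →
    (∀ i, e i = 1 ∨ e i = 2) → (∃ i, e i = 2) → (∀ i, ∀ x ∈ P, -1 < κ i x) →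
    (∀ i, e i = 2 → (∀ x ∈ P, 0 < κ i x) ∨ (∀ x ∈ P, κ i x ≤ 0)) →
    (∀ i, IntegrableOn (fun z : Fin (1 + 1) → ℝ =>
      c i (Fin.init z) * (z (Fin.last 1) ^ M i / (1 + z (Fin.last 1) ^ e i * κ i (Fin.init z))))
      {z : Fin (1 + 1) → ℝ | (Fin.init z : Fin 1 → ℝ) ∈ P ∧ z (Fin.last 1) ∈ Set.Ioo 0 1}) →
    (∀ i, IntegrableOn (fun x => c i x * ∫ θ in Set.Ioo (0 : ℝ) 1, θ ^ M i / (1 + θ ^ e i * κ i x)) P) →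
    V.domain = {z : Fin (1 + 1) → ℝ | (Fin.init z : Fin 1 → ℝ) ∈ P ∧ z (Fin.last 1) ∈ Set.Ioo 0 1} →
    Set.EqOn V.integrand (fun z => a₀ (Fin.init z) +
      ∑ i, c i (Fin.init z) * (z (Fin.last 1) ^ M i / (1 + z (Fin.last 1) ^ e i * κ i (Fin.init z))))
      V.domain →
    (∀ᵐ x : (Fin 1 → ℝ), x ∈ P →
      a₀ x + ∑ i, c i x * ∫ θ in Set.Ioo (0 : ℝ) 1, θ ^ M i / (1 + θ ^ e i * κ i x) = 0) →
    KZ.of V ∈ KZ.relations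

end Summit.KontsevichZagierPeriods.RootDecompRelativeModAbsolute.Rung30571.RegularisedLogLayer.CylLog.Leaf
end
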